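import Summits.QuantumAdvantage.QuantumAdvantage.Theses.SpinorFlattening
import Literature.Computability.QuantumComplexity.GaussianRank

/-!
# Transfer: C⁺ ⇒ crux 1246 (`FlatteningBoundRobust`) and C⁺ ⇒ kill crux 1245
(`NegApproxGaussRankSuperpoly`) — crux-ideate round 1, ideator 3, card `isometric-subflattening-bessel`

`FlatteningBoundBessel` (C⁺) is the fidelity-type sub-flattening bound
`C(t,K)8^K − r·D_K(4t) ≤ C(t,K)8^K · normSq(M^{⊗t} − Σ aᵢ gᵢ)`. This file machine-checks the two
REDUCTIONS claimed on the card (the bound C⁺ itself is the line's remaining work: deficiency +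
fullness + the proved lever `BesselSubflattening.subflattening_bound_qreg`):

* `flatteningBoundRobust_of_bessel : FlatteningBoundBessel → FlatteningBoundRobust`
  (uses only `C(t,K)·8^K ≤ C(8t,K)`, proved here as `choose_mul_pow_le`, and `normSq ≥ 0`);
* `negApprox_of_bessel : FlatteningBoundBessel → GrowthFact → NegApproxGaussRankSuperpoly` with
  `δ = 1/2`, where `GrowthFact := ∀ c, ∃ t K, 4 (t^c + c) D_K(4t) < 3 C(t,K) 8^K` is an elementary
  binomial growth statement (true: `C(t,K)8^K / D_K(4t) ≈ 2^{0.333 t}` at `K = ⌊4t/7⌋`);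
* `Growth.growthFact : GrowthFact` — PROVED below (witness `t = 2m`, `K = m`: `D_m(8m) ≤ (m+1)·C(8m,m)`,
  `C(8m,m) ≤ 7^m·C(2m,m)` by descending factorials, and `poly(m)·7^m < 3·8^m` eventually via
  `tendsto_pow_const_mul_const_pow_of_lt_one`);
* `Transfer.negApprox_of_bessel' : FlatteningBoundBessel → NegApproxGaussRankSuperpoly` — the kill
  crux 1245 now depends on C⁺ ALONE.
-/

set_option linter.dupNamespace false

noncomputable section

open Matrix Finset
open scoped BigOperators

namespace Summit.QuantumAdvantage.QuantumAdvantage.Cruxes.FlatteningBoundRobust.Transfer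

open Literature.Computability.QuantumComplexity Literature.Computability.Cryptography
open Summit.QuantumAdvantage.QuantumAdvantage.Theses.SpinorFlattening

/-- C⁺: the fidelity-type sub-flattening bound (card `Ideas/isometric-subflattening-bessel.md`),
over the landed API (`IsGaussian`, `magicMPow`, `flatteningDeficiency` are definitionally the
route's inline `IsGauss`, `Mpow`, `D_K`). -/
def FlatteningBoundBessel : Prop :=
  ∀ t K r : ℕ, ∀ (a : Fin r → ℂ) (g : Fin r → QReg (t * 4) → ℂ), (∀ i, IsGaussian (g i)) →
    ((t.choose K * 8 ^ K : ℕ) : ℝ) - ((r * flatteningDeficiency K (t * 4) : ℕ) : ℝ)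
      ≤ ((t.choose K * 8 ^ K : ℕ) : ℝ) * normSq (magicMPow t - ∑ i, a i • g i)

/-- The binomial growth fact consumed by `negApprox_of_bessel` (δ = 1/2). -/
def GrowthFact : Prop :=
  ∀ c : ℕ, ∃ t K : ℕ, 4 * ((t ^ c + c) * flatteningDeficiency K (t * 4)) < 3 * (t.choose K * 8 ^ K)

/-- Pascal iterated: `C(n, K+1) + m·C(n, K) ≤ C(n+m, K+1)`. [folklore] -/
theorem choose_succ_add_mul_le (n K : ℕ) : ∀ m : ℕ,
    n.choose (K + 1) + m * n.choose K ≤ (n + m).choose (K + 1)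
  | 0 => by simp
  | m + 1 => by
    have ih := choose_succ_add_mul_le n K m
    have hmono : n.choose K ≤ (n + m).choose K := Nat.choose_le_choose K (Nat.le_add_right n m)
    have hP : (n + (m + 1)).choose (K + 1) = (n + m).choose K + (n + m).choose (K + 1) := by
      rw [← Nat.add_assoc, Nat.choose_succ_succ']
    rw [hP]
    nlinarith [ih, hmono]

/-- One-per-block `K`-sets are `K`-subsets of the `8t` Majoranas: `C(t,K)·8^K ≤ C(8t,K)`,
proved by induction on `t` from Pascal's rule. [folklore] -/
theorem choose_mul_pow_le : ∀ t K : ℕ, t.choose K * 8 ^ K ≤ (t * 8).choose K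
  | 0, 0 => by simp
  | 0, K + 1 => by simp
  | t + 1, 0 => by simp
  | t + 1, K + 1 => by
    have ih0 := choose_mul_pow_le t K
    have ih1 := choose_mul_pow_le t (K + 1)
    have hA := choose_succ_add_mul_le (t * 8) K 8
    have hmul : (t + 1) * 8 = t * 8 + 8 := by ring
    have ih1' : t.choose (K + 1) * (8 ^ K * 8) ≤ (t * 8).choose (K + 1) := by
      rw [← pow_succ]; exact ih1
    rw [hmul, Nat.choose_succ_succ', pow_succ]
    have hsplit : (t.choose K + t.choose (K + 1)) * (8 ^ K * 8) =
        8 * (t.choose K * 8 ^ K) + t.choose (K + 1) * (8 ^ K * 8) := by ring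
    rw [hsplit]
    calc 8 * (t.choose K * 8 ^ K) + t.choose (K + 1) * (8 ^ K * 8)
        ≤ 8 * (t * 8).choose K + (t * 8).choose (K + 1) :=
          Nat.add_le_add (Nat.mul_le_mul_left 8 ih0) ih1'
      _ ≤ (t * 8 + 8).choose (K + 1) := by linarith [hA]

theorem normSq_nonneg' {n : ℕ} (ψ : QReg n → ℂ) : 0 ≤ normSq ψ := by
  unfold normSq
  positivity

/-- **C⁺ ⇒ crux 1246.** -/
theorem flatteningBoundRobust_of_bessel (h : FlatteningBoundBessel) : FlatteningBoundRobust := by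
  unfold FlatteningBoundRobust
  intro maj IsGauss Mpow t K r hlt a g hg
  have hg' : ∀ i, IsGaussian (g i) := hg
  have h1 := h t K r a g hg'
  show (1 : ℝ) ≤ (((t * 8).choose K : ℕ) : ℝ) * normSq (magicMPow t - ∑ i, a i • g i)
  have hlt' : r * flatteningDeficiency K (t * 4) + 1 ≤ t.choose K * 8 ^ K := hlt
  have hRC : t.choose K * 8 ^ K ≤ (t * 8).choose K := choose_mul_pow_le t K
  have hnn : 0 ≤ normSq (magicMPow t - ∑ i, a i • g i) := normSq_nonneg' _
  have e1 : (1 : ℝ) ≤ ((t.choose K * 8 ^ K : ℕ) : ℝ) - ((r * flatteningDeficiency K (t * 4) : ℕ) : ℝ) := by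
    have hc : (((r * flatteningDeficiency K (t * 4) + 1 : ℕ)) : ℝ) ≤ ((t.choose K * 8 ^ K : ℕ) : ℝ) := by
      exact_mod_cast hlt'
    push_cast at hc ⊢
    linarith
  have e2 : ((t.choose K * 8 ^ K : ℕ) : ℝ) ≤ (((t * 8).choose K : ℕ) : ℝ) := by exact_mod_cast hRC
  calc (1 : ℝ) ≤ ((t.choose K * 8 ^ K : ℕ) : ℝ) - ((r * flatteningDeficiency K (t * 4) : ℕ) : ℝ) := e1
    _ ≤ ((t.choose K * 8 ^ K : ℕ) : ℝ) * normSq (magicMPow t - ∑ i, a i • g i) := h1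
    _ ≤ (((t * 8).choose K : ℕ) : ℝ) * normSq (magicMPow t - ∑ i, a i • g i) :=
        mul_le_mul_of_nonneg_right e2 hnn

/-- **C⁺ + growth ⇒ kill crux 1245** (`δ = 1/2`): superpolynomial constant-precision approximate
Gaussian rank of `|M⟩^{⊗t}`, i.e. the route's target `GaussRankPolyThesis` is refuted. -/
theorem negApprox_of_bessel (h : FlatteningBoundBessel) (harith : GrowthFact) :
    NegApproxGaussRankSuperpoly := by
  unfold NegApproxGaussRankSuperpoly
  intro maj IsGauss Mpow
  refine ⟨1 / 2, by norm_num, by norm_num, ?_⟩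
  intro c
  obtain ⟨t, K, hK⟩ := harith c
  refine ⟨t, ?_⟩
  intro r hr a g hg
  have hg' : ∀ i, IsGaussian (g i) := hg
  have h1 := h t K r a g hg'
  show (1 / 2 : ℝ) ^ 2 < normSq (magicMPow t - ∑ i, a i • g i)
  have h4 : 4 * (r * flatteningDeficiency K (t * 4)) < 3 * (t.choose K * 8 ^ K) :=
    lt_of_le_of_lt (Nat.mul_le_mul_left 4 (Nat.mul_le_mul_right _ hr)) hK
  have hRpos : 0 < t.choose K * 8 ^ K := by omega
  have h4' : (4 : ℝ) * ((r * flatteningDeficiency K (t * 4) : ℕ) : ℝ) <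
      3 * ((t.choose K * 8 ^ K : ℕ) : ℝ) := by exact_mod_cast h4
  have hRpos' : (0 : ℝ) < ((t.choose K * 8 ^ K : ℕ) : ℝ) := by exact_mod_cast hRpos
  by_contra hcon
  push Not at hcon
  have hle : ((t.choose K * 8 ^ K : ℕ) : ℝ) * normSq (magicMPow t - ∑ i, a i • g i) ≤
      ((t.choose K * 8 ^ K : ℕ) : ℝ) * (1 / 2) ^ 2 := mul_le_mul_of_nonneg_left hcon hRpos'.le
  nlinarith [h1, hle, h4', hRpos']

end Summit.QuantumAdvantage.QuantumAdvantage.Cruxes.FlatteningBoundRobust.Transfer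

open Filter Topology


namespace Summit.QuantumAdvantage.QuantumAdvantage.Cruxes.FlatteningBoundRobust.Growth

open Literature.Computability.QuantumComplexity

/-- Binomial coefficients increase up to the middle: `C(n, j) ≤ C(n, j + d)` if `j + d ≤ n / 2`. -/
theorem choose_le_choose_add {n j : ℕ} : ∀ d : ℕ, j + d ≤ n / 2 → n.choose j ≤ n.choose (j + d)
  | 0, _ => le_rfl
  | d + 1, h => by
    have h1 : j + d ≤ n / 2 := by omega
    have h2 : j + d < n / 2 := by omega
    calc n.choose j ≤ n.choose (j + d) := choose_le_choose_add d h1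
      _ ≤ n.choose (j + d + 1) := Nat.choose_le_succ_of_lt_half_left h2

/-- `D_m(8m) ≤ (m+1) · C(8m, m)`. -/
theorem deficiency_le (m : ℕ) :
    flatteningDeficiency m (2 * m * 4) ≤ (m + 1) * (8 * m).choose m := by
  rw [flatteningDeficiency_eq]
  have h8 : 2 * m * 4 = 8 * m := by ring
  rw [h8]
  calc (∑ j ∈ (range (m + 1)).filter (fun j => j % 2 = m % 2), (8 * m).choose j)
      ≤ ∑ j ∈ range (m + 1), (8 * m).choose j :=
        sum_le_sum_of_subset_of_nonneg (filter_subset _ _) (fun _ _ _ => Nat.zero_le _)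
    _ ≤ ∑ _j ∈ range (m + 1), (8 * m).choose m := by
        refine sum_le_sum fun j hj => ?_
        have hjm : j ≤ m := Nat.lt_succ_iff.mp (mem_range.mp hj)
        have := choose_le_choose_add (n := 8 * m) (j := j) (m - j) (by omega)
        rwa [Nat.add_sub_cancel' hjm] at this
    _ = (m + 1) * (8 * m).choose m := by rw [sum_const, card_range, smul_eq_mul]

/-- Descending factorials: `(8m)(8m-1)⋯(8m-k+1) ≤ 7^k · (2m)(2m-1)⋯(2m-k+1)` for `k ≤ m`. -/
theorem descFactorial_le (m : ℕ) : ∀ k : ℕ, k ≤ m →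
    (8 * m).descFactorial k ≤ 7 ^ k * (2 * m).descFactorial k
  | 0, _ => by simp
  | k + 1, hk => by
    have ih := descFactorial_le m k (Nat.le_of_succ_le hk)
    rw [Nat.descFactorial_succ, Nat.descFactorial_succ, pow_succ]
    have hfac : 8 * m - k ≤ 7 * (2 * m - k) := by omega
    calc (8 * m - k) * (8 * m).descFactorial k
        ≤ (7 * (2 * m - k)) * (7 ^ k * (2 * m).descFactorial k) := Nat.mul_le_mul hfac ih
      _ = 7 ^ k * 7 * ((2 * m - k) * (2 * m).descFactorial k) := by ring

/-- `C(8m, m) ≤ 7^m · C(2m, m)`. -/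
theorem choose_eight_le (m : ℕ) : (8 * m).choose m ≤ 7 ^ m * (2 * m).choose m := by
  have h := descFactorial_le m m le_rfl
  rw [Nat.descFactorial_eq_factorial_mul_choose, Nat.descFactorial_eq_factorial_mul_choose] at h
  have hpos : 0 < m.factorial := Nat.factorial_pos m
  have h' : m.factorial * (8 * m).choose m ≤ m.factorial * (7 ^ m * (2 * m).choose m) := by
    calc m.factorial * (8 * m).choose m ≤ 7 ^ m * (m.factorial * (2 * m).choose m) := h
      _ = m.factorial * (7 ^ m * (2 * m).choose m) := by ring
  exact Nat.le_of_mul_le_mul_left h' hpos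

/-- The exponential beats the polynomial: eventually `4 ((2m)^c + c) (m+1) 7^m < 3 · 8^m`. -/
theorem eventually_poly_seven_lt_eight (c : ℕ) :
    ∃ m : ℕ, 1 ≤ m ∧ 4 * (((2 * m) ^ c + c) * (m + 1)) * 7 ^ m < 3 * 8 ^ m := by
  -- real-analytic core: m^{c+1} (7/8)^m → 0
  have hlim := tendsto_pow_const_mul_const_pow_of_lt_one (c + 1) (r := (7 / 8 : ℝ))
    (by norm_num) (by norm_num)
  set A : ℝ := 8 * (2 ^ c + c) with hA
  have hApos : 0 < A := by positivity
  have hε : (0 : ℝ) < 3 / A := by positivity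
  have hev : ∀ᶠ m : ℕ in atTop, (m : ℝ) ^ (c + 1) * (7 / 8 : ℝ) ^ m < 3 / A :=
    Filter.Tendsto.eventually_lt hlim tendsto_const_nhds hε
  obtain ⟨m, hm1, hm⟩ := ((eventually_ge_atTop 1).and hev).exists
  refine ⟨m, hm1, ?_⟩
  -- polynomial bookkeeping in ℝ
  have hmR : (1 : ℝ) ≤ m := by exact_mod_cast hm1
  have hpoly : (4 : ℝ) * (((2 * m : ℝ) ^ c + c) * (m + 1)) ≤ A * (m : ℝ) ^ (c + 1) := by
    have h1 : (2 * m : ℝ) ^ c + c ≤ (2 ^ c + c) * (m : ℝ) ^ c := by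
      have hmc : (1 : ℝ) ≤ (m : ℝ) ^ c := one_le_pow₀ hmR
      have : (c : ℝ) ≤ c * (m : ℝ) ^ c := by nlinarith [Nat.cast_nonneg (α := ℝ) c]
      rw [mul_pow]; nlinarith
    have h2 : (m : ℝ) + 1 ≤ 2 * m := by linarith
    have hnn : 0 ≤ (2 * m : ℝ) ^ c + c := by positivity
    calc (4 : ℝ) * (((2 * m : ℝ) ^ c + c) * (m + 1))
        ≤ 4 * (((2 ^ c + c) * (m : ℝ) ^ c) * (2 * m)) := by
          gcongr
      _ = A * (m : ℝ) ^ (c + 1) := by rw [hA]; ring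
  have h78 : (7 : ℝ) ^ m = (7 / 8 : ℝ) ^ m * 8 ^ m := by
    rw [← mul_pow]; norm_num
  have key : (4 : ℝ) * (((2 * m : ℝ) ^ c + c) * (m + 1)) * 7 ^ m < 3 * 8 ^ m := by
    have h8pos : (0 : ℝ) < 8 ^ m := by positivity
    have hstep : A * (m : ℝ) ^ (c + 1) * ((7 / 8 : ℝ) ^ m * 8 ^ m) < 3 * 8 ^ m := by
      have : A * ((m : ℝ) ^ (c + 1) * (7 / 8 : ℝ) ^ m) < A * (3 / A) := mul_lt_mul_of_pos_left hm hApos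
      rw [mul_div_cancel₀ _ hApos.ne'] at this
      nlinarith
    calc (4 : ℝ) * (((2 * m : ℝ) ^ c + c) * (m + 1)) * 7 ^ m
        ≤ A * (m : ℝ) ^ (c + 1) * 7 ^ m := by gcongr
      _ = A * (m : ℝ) ^ (c + 1) * ((7 / 8 : ℝ) ^ m * 8 ^ m) := by rw [h78]
      _ < 3 * 8 ^ m := hstep
  exact_mod_cast key

/-- **GrowthFact.** `∀ c, ∃ t K, 4 (t^c + c) · D_K(4t) < 3 · C(t,K) · 8^K`. -/
theorem growthFact (c : ℕ) : ∃ t K : ℕ,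
    4 * ((t ^ c + c) * flatteningDeficiency K (t * 4)) < 3 * (t.choose K * 8 ^ K) := by
  obtain ⟨m, hm1, hm⟩ := eventually_poly_seven_lt_eight c
  refine ⟨2 * m, m, ?_⟩
  have hD := deficiency_le m
  have hC := choose_eight_le m
  have hpos : 0 < (2 * m).choose m := Nat.choose_pos (by omega)
  calc 4 * (((2 * m) ^ c + c) * flatteningDeficiency m (2 * m * 4))
      ≤ 4 * (((2 * m) ^ c + c) * ((m + 1) * (8 * m).choose m)) := by gcongr
    _ ≤ 4 * (((2 * m) ^ c + c) * ((m + 1) * (7 ^ m * (2 * m).choose m))) := by gcongr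
    _ = (4 * (((2 * m) ^ c + c) * (m + 1)) * 7 ^ m) * (2 * m).choose m := by ring
    _ < (3 * 8 ^ m) * (2 * m).choose m := Nat.mul_lt_mul_of_pos_right hm hpos
    _ = 3 * ((2 * m).choose m * 8 ^ m) := by ring

/-- General form: for every constant `A`, eventually `A ((2m)^c + c)(m+1) 7^m < 8^m`. -/
theorem eventually_const_poly_seven_lt_eight (A c : ℕ) :
    ∃ m : ℕ, 1 ≤ m ∧ A * (((2 * m) ^ c + c) * (m + 1)) * 7 ^ m < 8 ^ m := by
  have hlim := tendsto_pow_const_mul_const_pow_of_lt_one (c + 1) (r := (7 / 8 : ℝ))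
    (by norm_num) (by norm_num)
  set B : ℝ := 2 * (A + 1) * (2 ^ c + c) with hB
  have hBpos : 0 < B := by positivity
  have hε : (0 : ℝ) < 1 / B := by positivity
  have hev : ∀ᶠ m : ℕ in atTop, (m : ℝ) ^ (c + 1) * (7 / 8 : ℝ) ^ m < 1 / B :=
    Filter.Tendsto.eventually_lt hlim tendsto_const_nhds hε
  obtain ⟨m, hm1, hm⟩ := ((eventually_ge_atTop 1).and hev).exists
  refine ⟨m, hm1, ?_⟩
  have hmR : (1 : ℝ) ≤ m := by exact_mod_cast hm1
  have hpoly : (A : ℝ) * (((2 * m : ℝ) ^ c + c) * (m + 1)) ≤ B * (m : ℝ) ^ (c + 1) := by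
    have h1 : (2 * m : ℝ) ^ c + c ≤ (2 ^ c + c) * (m : ℝ) ^ c := by
      have hmc : (1 : ℝ) ≤ (m : ℝ) ^ c := one_le_pow₀ hmR
      have : (c : ℝ) ≤ c * (m : ℝ) ^ c := by nlinarith [Nat.cast_nonneg (α := ℝ) c]
      rw [mul_pow]; nlinarith
    have h2 : (m : ℝ) + 1 ≤ 2 * m := by linarith
    have hA1 : (A : ℝ) ≤ A + 1 := by linarith
    have hnn : 0 ≤ (2 * m : ℝ) ^ c + c := by positivity
    calc (A : ℝ) * (((2 * m : ℝ) ^ c + c) * (m + 1))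
        ≤ (A + 1) * (((2 ^ c + c) * (m : ℝ) ^ c) * (2 * m)) := by gcongr
      _ = B * (m : ℝ) ^ (c + 1) := by rw [hB]; ring
  have h78 : (7 : ℝ) ^ m = (7 / 8 : ℝ) ^ m * 8 ^ m := by
    rw [← mul_pow]; norm_num
  have key : (A : ℝ) * (((2 * m : ℝ) ^ c + c) * (m + 1)) * 7 ^ m < 8 ^ m := by
    have h8pos : (0 : ℝ) < 8 ^ m := by positivity
    have hstep : B * (m : ℝ) ^ (c + 1) * ((7 / 8 : ℝ) ^ m * 8 ^ m) < 8 ^ m := by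
      have : B * ((m : ℝ) ^ (c + 1) * (7 / 8 : ℝ) ^ m) < B * (1 / B) := mul_lt_mul_of_pos_left hm hBpos
      rw [mul_div_cancel₀ _ hBpos.ne'] at this
      nlinarith
    calc (A : ℝ) * (((2 * m : ℝ) ^ c + c) * (m + 1)) * 7 ^ m
        ≤ B * (m : ℝ) ^ (c + 1) * 7 ^ m := by gcongr
      _ = B * (m : ℝ) ^ (c + 1) * ((7 / 8 : ℝ) ^ m * 8 ^ m) := by rw [h78]
      _ < 8 ^ m := hstep
  exact_mod_cast key

/-- **countGap, ℕ-form** — the shape of `stub_countGap` of the sibling crux 1245's picked line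
`spectral-mass-flattening` (there stated with `Fintype.card` of the degree-`K` block patterns, which
equals `C(t,K)·8^K`): `∀ c, ∃ t K, 2 (t^c + c) · D_K(4t) < C(t,K) · 8^K`. Witness `t = 2m`, `K = m`. -/
theorem countGap_nat (c : ℕ) : ∃ t K : ℕ,
    2 * (t ^ c + c) * flatteningDeficiency K (t * 4) < t.choose K * 8 ^ K := by
  obtain ⟨m, hm1, hm⟩ := eventually_const_poly_seven_lt_eight 2 c
  refine ⟨2 * m, m, ?_⟩
  have hD := deficiency_le m
  have hC := choose_eight_le m
  have hpos : 0 < (2 * m).choose m := Nat.choose_pos (by omega)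
  calc 2 * ((2 * m) ^ c + c) * flatteningDeficiency m (2 * m * 4)
      ≤ 2 * ((2 * m) ^ c + c) * ((m + 1) * (8 * m).choose m) := by gcongr
    _ ≤ 2 * ((2 * m) ^ c + c) * ((m + 1) * (7 ^ m * (2 * m).choose m)) := by gcongr
    _ = (2 * (((2 * m) ^ c + c) * (m + 1)) * 7 ^ m) * (2 * m).choose m := by ring
    _ < 8 ^ m * (2 * m).choose m := Nat.mul_lt_mul_of_pos_right hm hpos
    _ = (2 * m).choose m * 8 ^ m := by ring

end Summit.QuantumAdvantage.QuantumAdvantage.Cruxes.FlatteningBoundRobust.Growth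

namespace Summit.QuantumAdvantage.QuantumAdvantage.Cruxes.FlatteningBoundRobust.Transfer

/-- **C⁺ ALONE ⇒ kill crux 1245.** -/
theorem negApprox_of_bessel' (h : FlatteningBoundBessel) :
    Summit.QuantumAdvantage.QuantumAdvantage.Theses.SpinorFlattening.NegApproxGaussRankSuperpoly :=
  negApprox_of_bessel h Growth.growthFact

end Summit.QuantumAdvantage.QuantumAdvantage.Cruxes.FlatteningBoundRobust.Transfer
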